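import Literature.NumberTheory.EllipticCurves.Greenberg1999.TwoTorsionRamifiedIsogenyDualProofs
import Literature.NumberTheory.EllipticCurves.IsogenyTwoPowerQuotientProofs
import Literature.NumberTheory.EllipticCurves.GlobalMinimalModelProofs
import HarnessLib

/-!
# The explicit `2`-isogeny step of the `2`-power isogeny walk (line `nsf`, crux `StarOptBNSF`, stmt-BirchSwinnertonDyer-27047)

Helper file for the registered stub `stub_twoPowerWalk` of line `nsf` v2 (planner bsd-rank2-p2 GEN 32): the ONE STEP of the
h-invariant walk along a rational `2`-isogeny, packaged so that the walk itself never sees explicit models.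

* §1 Rational points of order `2` in three currencies: the tree's `HasRationalTwoTorsionX E s` (a rational `y` with
  `f(s, y) = 0`, `2y + a₁s + a₃ = 0`), a rational affine point `(s, y)` with `2 • (s, y) = O`, and the geometric point
  `toGeomPoints E (s, y) ∈ E(ℚ̄)` (nonzero, killed by `2`, `Γ_ℚ`-fixed); Galois descent of a `Γ_ℚ`-fixed geometric point of
  order `2` (`exists_eq_toGeomPoints_of_two_torsion`, via the tree's `exists_toGeomPoints_eq_of_forall_smul_eq`).
* §2 `twoIsogenyStep`: for a globally minimal elliptic `E/ℚ` and a rational point `S = (s, y)` of order `2` there are a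
  GLOBALLY MINIMAL elliptic `E₁/ℚ`, an isogeny `π : E → E₁` over `ℚ` and a rational point `S₁ = (s₁, y₁)` of order `2` on
  `E₁` with: `ker π = {O, S}`; `π` maps every geometric point of order `2` other than `S` to `S₁` (the generator of the dual
  kernel); and the EDGE LAWS of the cell bsd-2adic (Greenberg 1999 §5, tree theorems
  `Greenberg1999.ramified_odd_dual_of_twoIsogeny_of_goodOrd_or_mult`): under good-ordinary-or-multiplicative reduction at `2`
  of `E` and `E₁`, `s` is ramified at `2` iff `s₁` is not, and `s` is odd iff `s₁` is not.  Construction: `C = (1, s, −a₁/2, y)`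
  puts `S` at `(0,0)` on a two-torsion normal form (`isTwoTorsionNF_smul_of_two_nsmul_eq_zero`), Silverman's explicit
  `2`-isogeny `twoIsogeny` (AEC III.4.5) maps to `Y² = X(X² − 2aX + a² − 4b)`, and a change of variables `D`
  (`hasGlobalMinimalModel_rat_holds`, AEC VIII.8.3) reaches a global minimal model; `π = ι_D ∘ φ ∘ ι_C`, `S₁ = ι_D(0,0)`,
  `s₁ = (D⁻¹).r`.

HONEST FRAMING: bookkeeping for an OPEN stub; nothing here proves `StarOptBNSF`, E1M_NSF or BSD.  Fact-free.

References: J. H. Silverman, *The Arithmetic of Elliptic Curves*, 2nd ed. (2009), III.1, III.4 Example 4.5, VIII.§1, VIII.8.3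
[SilvermanAEC2009]; R. Greenberg, LNM 1716 (1999), §5 [GreenbergLNM1716].
-/

set_option linter.dupNamespace false
set_option autoImplicit false

noncomputable section

open scoped Classical

open WeierstrassCurve Literature.NumberTheory.EllipticCurves Literature.NumberTheory.EllipticCurves.Greenberg1999

namespace Summit.BirchSwinnertonDyer.BirchSwinnertonDyer.Theorems.DepletionAtTwo.Walk

/-! ### §1 Rational points of order `2`: three currencies -/

section Dictionary

variable (E : WeierstrassCurve ℚ)

/-- `HasRationalTwoTorsionX E s` gives a rational affine point `(s, y)` (nonsingular, `E` being elliptic) with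
`2y + a₁s + a₃ = 0`. [cite: SilvermanAEC2009, III.2.3 (negation formula)] -/
theorem exists_nonsingular_of_hasRationalTwoTorsionX [E.IsElliptic] {s : ℚ} (h : HasRationalTwoTorsionX E s) :
    ∃ (y : ℚ) (_ : E.toAffine.Nonsingular s y), 2 * y + E.a₁ * s + E.a₃ = 0 := by
  obtain ⟨y, heq, hy⟩ := h
  exact ⟨y, Affine.equation_iff_nonsingular.mp heq, hy⟩

variable {E}

/-- A nonsingular rational point `(s, y)` with `2y + a₁s + a₃ = 0` witnesses `HasRationalTwoTorsionX E s`. [folklore] -/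
theorem hasRationalTwoTorsionX_of_nonsingular {s y : ℚ} (hP : E.toAffine.Nonsingular s y)
    (hy : 2 * y + E.a₁ * s + E.a₃ = 0) : HasRationalTwoTorsionX E s :=
  ⟨y, hP.1, hy⟩

/-- The `y`-coordinate of a rational point of order `2` is determined by its `x`-coordinate. [folklore] -/
theorem y_eq_of_two_mul_add_eq_zero {s y y' : ℚ} (hy : 2 * y + E.a₁ * s + E.a₃ = 0)
    (hy' : 2 * y' + E.a₁ * s + E.a₃ = 0) : y = y' := by
  linear_combination (hy - hy') / 2

/-- The `x`-coordinate of a rational point of order `2` is a root of the `2`-division cubic; in particular two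
rational points of order `2` that are both "odd" (least real root) have the same `x`-coordinate. [folklore] -/
theorem eq_of_twoTorsionOdd_of_twoTorsionOdd {s t : ℚ} (hs : HasRationalTwoTorsionX E s) (ht : HasRationalTwoTorsionX E t)
    (hso : TwoTorsionOdd E s) (hto : TwoTorsionOdd E t) : s = t := by
  obtain ⟨ys, hEs, hys⟩ := hs
  obtain ⟨yt, hEt, hyt⟩ := ht
  have hcs := fourXCubed_add_eq_zero_of_twoTorsion hEs hys
  have hct := fourXCubed_add_eq_zero_of_twoTorsion hEt hyt
  have h1 : (s : ℝ) ≤ t := hso t (by exact_mod_cast hct)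
  have h2 : (t : ℝ) ≤ s := hto s (by exact_mod_cast hcs)
  exact_mod_cast le_antisymm h1 h2

/-- The geometric point of a rational affine point is `toGeomPoints E (s, y) = (s, y) ∈ E(ℚ̄)` (coordinates read in `ℚ̄`).
[folklore] -/
theorem toGeomPoints_some {s y : ℚ} (hP : E.toAffine.Nonsingular s y) :
    ∃ h', toGeomPoints E (Affine.Point.some s y hP) =
      (Affine.Point.some (algebraMap ℚ (AlgebraicClosure ℚ) s) (algebraMap ℚ (AlgebraicClosure ℚ) y) h' : E.geomPoints) :=
  ⟨_, rfl⟩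

/-- The geometric point of a rational point of order `2` is nonzero, killed by `2` and `Γ_ℚ`-fixed. [folklore] -/
theorem toGeomPoints_two_torsion {s y : ℚ} (hP : E.toAffine.Nonsingular s y) (hy : 2 * y + E.a₁ * s + E.a₃ = 0) :
    toGeomPoints E (Affine.Point.some s y hP) ≠ 0 ∧
      toGeomPoints E (Affine.Point.some s y hP) + toGeomPoints E (Affine.Point.some s y hP) = 0 ∧
      ∀ σ : Field.absoluteGaloisGroup ℚ, σ • toGeomPoints E (Affine.Point.some s y hP) = toGeomPoints E (Affine.Point.some s y hP) := by
  obtain ⟨h', e'⟩ := toGeomPoints_some (E := E) hP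
  refine ⟨fun h0 ↦ ?_, ?_, fun σ ↦ smul_toGeomPoints E σ _⟩
  · rw [e'] at h0
    exact Affine.Point.some_ne_zero h' h0
  · set f : ℚ →+* (AlgebraicClosure ℚ) := algebraMap ℚ (AlgebraicClosure ℚ) with hf
    have h2 : 2 * f y + f E.a₁ * f s + f E.a₃ = 0 := by
      have := congrArg f hy
      simpa only [map_add, map_mul, map_ofNat, map_zero] using this
    have hneg : f y = (E.baseChange (AlgebraicClosure ℚ)).toAffine.negY (f s) (f y) := by
      change f y = -f y - f E.a₁ * f s - f E.a₃
      linear_combination h2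
    rw [e']
    exact Affine.Point.add_self_of_Y_eq hneg

/-- **Galois descent of a point of order `2`.** A nonzero `Γ_ℚ`-fixed geometric point `S` with `S + S = O` is the geometric
point of a rational affine point `(s, y)` with `2y + a₁s + a₃ = 0` (tree: `exists_toGeomPoints_eq_of_forall_smul_eq`).
[cite: SilvermanAEC2009, VIII.§1] -/
theorem exists_eq_toGeomPoints_of_two_torsion [E.IsElliptic] {S : E.geomPoints} (h0 : S ≠ 0) (h2 : S + S = 0)
    (hfix : ∀ σ : Field.absoluteGaloisGroup ℚ, σ • S = S) :
    ∃ (s y : ℚ) (hP : E.toAffine.Nonsingular s y), S = toGeomPoints E (Affine.Point.some s y hP) ∧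
      2 * y + E.a₁ * s + E.a₃ = 0 := by
  obtain ⟨P, hPS⟩ := exists_toGeomPoints_eq_of_forall_smul_eq E hfix
  rcases P with _ | ⟨s, y, hsy⟩
  · exact absurd ((map_zero (toGeomPoints E)).symm.trans hPS) h0.symm
  · refine ⟨s, y, hsy, hPS.symm, ?_⟩
    obtain ⟨h', e'⟩ := toGeomPoints_some (E := E) hsy
    set f : ℚ →+* (AlgebraicClosure ℚ) := algebraMap ℚ (AlgebraicClosure ℚ) with hf
    rw [← hPS, e'] at h2
    have hneg : Affine.Point.some (f s) (f y) h' = -Affine.Point.some (f s) (f y) h' := add_eq_zero_iff_eq_neg.mp h2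
    rw [Affine.Point.neg_some] at hneg
    have hY : f y = (E.baseChange (AlgebraicClosure ℚ)).toAffine.negY (f s) (f y) := (Affine.Point.some.inj hneg).2
    change f y = -f y - f E.a₁ * f s - f E.a₃ at hY
    apply f.injective
    have e : f (2 * y + E.a₁ * s + E.a₃) = 2 * f y + f E.a₁ * f s + f E.a₃ := by
      simp only [map_add, map_mul, map_ofNat]
    rw [map_zero, e]
    linear_combination hY

/-- Rational points of order `2` have the same geometric point iff they have the same `x`-coordinate. [folklore] -/
theorem toGeomPoints_some_eq_iff {s y t y' : ℚ} (hP : E.toAffine.Nonsingular s y) (hQ : E.toAffine.Nonsingular t y')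
    (hy : 2 * y + E.a₁ * s + E.a₃ = 0) (hy' : 2 * y' + E.a₁ * t + E.a₃ = 0) :
    toGeomPoints E (Affine.Point.some s y hP) = toGeomPoints E (Affine.Point.some t y' hQ) ↔ s = t := by
  constructor
  · intro h
    have h' := toGeomPoints_injective E h
    simp only [Affine.Point.some.injEq] at h'
    exact h'.1
  · rintro rfl
    have hyy : y = y' := y_eq_of_two_mul_add_eq_zero hy hy'
    subst hyy
    rfl

end Dictionary

/-! ### §2 The explicit `2`-isogeny step -/

section Step

variable (E : WeierstrassCurve ℚ) [E.IsElliptic]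

/-- The change of variables `C = (1, s, −a₁/2, y)` maps the rational point `(s, y)` of order `2` to `T = (0, 0)` of the
two-torsion normal form `C • E` (on geometric points). [cite: SilvermanAEC2009, III.1 Table 3.1] -/
theorem toIsogeny_toGeomPoints_eq_geomTwoTorsionPoint {s y : ℚ} (hP : E.toAffine.Nonsingular s y)
    (hy : 2 * y + E.a₁ * s + E.a₃ = 0) :
    haveI : ((⟨1, s, -E.a₁ / 2, y⟩ : VariableChange ℚ) • E).IsTwoTorsionNF :=
      isTwoTorsionNF_smul_of_two_nsmul_eq_zero two_ne_zero hP (by rw [Affine.negY]; linear_combination hy)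
    VariableChange.toIsogeny E ⟨1, s, -E.a₁ / 2, y⟩ (toGeomPoints E (Affine.Point.some s y hP)) =
      ((⟨1, s, -E.a₁ / 2, y⟩ : VariableChange ℚ) • E).geomTwoTorsionPoint := by
  set C : VariableChange ℚ := ⟨1, s, -E.a₁ / 2, y⟩ with hC
  obtain ⟨hns, e₀⟩ := toGeomPoints_some (E := E) hP
  rw [e₀, VariableChange.toIsogeny_some]
  have hx : (C.map (algebraMap ℚ (AlgebraicClosure ℚ))).toX (algebraMap ℚ (AlgebraicClosure ℚ) s) = 0 := by
    simp [hC, VariableChange.toX_def, VariableChange.map]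
  have hy0 : (C.map (algebraMap ℚ (AlgebraicClosure ℚ))).toY (algebraMap ℚ (AlgebraicClosure ℚ) s)
      (algebraMap ℚ (AlgebraicClosure ℚ) y) = 0 := by
    simp [hC, VariableChange.toY_def, VariableChange.map]
  obtain ⟨h', e'⟩ := WeierstrassCurve.some_eq_some_of_eq
    ((VariableChange.baseChange_smul_eq E C (AlgebraicClosure ℚ)) ▸
      (VariableChange.nonsingular_iff (E.baseChange (AlgebraicClosure ℚ))
        (C.map (algebraMap ℚ (AlgebraicClosure ℚ))) _ _).mpr hns) hx hy0
  exact e'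

/-- In a two-torsion normal form `y² = x³ + ax² + bx` over a field with `2 ≠ 0`, an affine point `(x, y)` of order `2`
with `x ≠ 0` has `y = 0` and `x² + ax + b = 0`, so both coordinates `(x² + ax + b)/x`, `y(x² − b)/x²` of its image under
Silverman's `2`-isogeny vanish. [cite: SilvermanAEC2009, III.4 Example 4.5] -/
theorem twoIsogenyX_eq_zero_of_two_torsion {F : Type*} [Field F] (V : WeierstrassCurve F) [V.IsTwoTorsionNF]
    (h2F : (2 : F) ≠ 0) {x y : F} (h : V.toAffine.Nonsingular x y)
    (h2 : (Affine.Point.some x y h : V.toAffine.Point) + Affine.Point.some x y h = 0) (hx : x ≠ 0) :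
    V.twoIsogenyX x = 0 ∧ V.twoIsogenyY x y = 0 := by
  have hneg : Affine.Point.some x y h = -Affine.Point.some x y h := add_eq_zero_iff_eq_neg.mp h2
  rw [Affine.Point.neg_some] at hneg
  have hy : y = V.toAffine.negY x y := (Affine.Point.some.inj hneg).2
  rw [negY_of_isTwoTorsionNF] at hy
  have hy0 : y = 0 := by
    have : (2 : F) * y = 0 := by linear_combination hy
    exact (mul_eq_zero.mp this).resolve_left h2F
  subst hy0
  have heq := (equation_iff_of_isTwoTorsionNF V x 0).mp h.1
  have hquad : x ^ 2 + V.a₂ * x + V.a₄ = 0 := by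
    have : x * (x ^ 2 + V.a₂ * x + V.a₄) = 0 := by linear_combination -heq
    exact (mul_eq_zero.mp this).resolve_left hx
  refine ⟨?_, ?_⟩
  · rw [twoIsogenyX, hquad, zero_div]
  · rw [twoIsogenyY, zero_mul, zero_div]

/-- In a two-torsion normal form `V : y² = x³ + ax² + bx` (elliptic, over `ℚ`), Silverman's `2`-isogeny maps every geometric
point of order `2` other than `T = (0,0)` to the point `(0, 0)` of the codomain `Y² = X³ − 2aX² + (a² − 4b)X` (the generator
of the dual kernel). [cite: SilvermanAEC2009, III.4 Example 4.5] -/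
theorem twoIsogeny_eq_geomTwoTorsionPoint (V : WeierstrassCurve ℚ) [V.IsTwoTorsionNF] [V.IsElliptic] {T : V.geomPoints}
    (h0 : T ≠ 0) (h2 : T + T = 0) (hT : T ≠ V.geomTwoTorsionPoint) :
    V.twoIsogeny T = V.twoIsogenyCodomain.geomTwoTorsionPoint := by
  obtain ⟨x, y, h, hx, rfl⟩ := exists_eq_some_of_ne V h0 hT
  obtain ⟨hX, hY⟩ := twoIsogenyX_eq_zero_of_two_torsion _ two_ne_zero h h2 hx
  obtain ⟨h', e'⟩ := twoIsogenyGeomHom_some V h hx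
  rw [twoIsogeny_apply, e']
  obtain ⟨h'', e''⟩ := WeierstrassCurve.some_eq_some_of_eq h' hX hY
  rw [e'']
  rfl

/-- A change of variables `D` maps the point `(0,0)` of a two-torsion normal form `V` to the rational point
`((D⁻¹).r, (D⁻¹).t)` of `D • V` (on geometric points). [cite: SilvermanAEC2009, III.1 Table 3.1] -/
theorem toIsogeny_geomTwoTorsionPoint (V : WeierstrassCurve ℚ) [V.IsTwoTorsionNF] [V.IsElliptic] (D : VariableChange ℚ)
    (hP₁ : (D • V).toAffine.Nonsingular (D⁻¹).r (D⁻¹).t) :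
    VariableChange.toIsogeny V D V.geomTwoTorsionPoint = toGeomPoints (D • V) (Affine.Point.some (D⁻¹).r (D⁻¹).t hP₁) := by
  obtain ⟨hns, e₀⟩ := toGeomPoints_some (E := D • V) hP₁
  rw [e₀]
  have e₁ : V.geomTwoTorsionPoint = (Affine.Point.some 0 0 (nonsingular_zero_zero (V.baseChange (AlgebraicClosure ℚ))) :
      V.geomPoints) := rfl
  rw [e₁, VariableChange.toIsogeny_some]
  have hx : (D.map (algebraMap ℚ (AlgebraicClosure ℚ))).toX 0 = algebraMap ℚ (AlgebraicClosure ℚ) (D⁻¹).r := by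
    simp [VariableChange.toX_def, VariableChange.map, VariableChange.inv_def]
    ring
  have hy : (D.map (algebraMap ℚ (AlgebraicClosure ℚ))).toY 0 0 = algebraMap ℚ (AlgebraicClosure ℚ) (D⁻¹).t := by
    simp [VariableChange.toY_def, VariableChange.map, VariableChange.inv_def]
    ring
  obtain ⟨h', e'⟩ := WeierstrassCurve.some_eq_some_of_eq
    ((VariableChange.baseChange_smul_eq V D (AlgebraicClosure ℚ)) ▸
      (VariableChange.nonsingular_iff (V.baseChange (AlgebraicClosure ℚ))
        (D.map (algebraMap ℚ (AlgebraicClosure ℚ))) _ _).mpr (nonsingular_zero_zero _)) hx hy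
  exact e'

variable [E.IsGloballyMinimal]

/-- **The `2`-isogeny step.**  For a globally minimal elliptic `E/ℚ` and a rational point `S = (s, y)` of order `2` there
are a globally minimal elliptic `E₁/ℚ`, an isogeny `π : E → E₁` over `ℚ` and a rational point `S₁ = (s₁, y₁)` of order
`2` on `E₁` such that: `ker π = {O, S}`; every geometric point `T ≠ S` of order `2` maps to `S₁`; and, if `E` and `E₁`
have good ordinary or multiplicative reduction at `2`, the Greenberg type bits FLIP: `s` ramified at `2` iff `s₁` is not,
`s` odd iff `s₁` is not (Silverman AEC III.4.5 + VIII.8.3; Greenberg 1999 §5, tree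
`Greenberg1999.ramified_odd_dual_of_twoIsogeny_of_goodOrd_or_mult`).
[cite: SilvermanAEC2009, III.4 Example 4.5 and Cor. VIII.8.3] -/
theorem twoIsogenyStep {s y : ℚ} (hP : E.toAffine.Nonsingular s y) (hy : 2 * y + E.a₁ * s + E.a₃ = 0) :
    ∃ (E₁ : WeierstrassCurve ℚ) (_ : E₁.IsElliptic) (_ : E₁.IsGloballyMinimal) (π : Isogeny E E₁) (s₁ y₁ : ℚ)
      (hP₁ : E₁.toAffine.Nonsingular s₁ y₁),
      2 * y₁ + E₁.a₁ * s₁ + E₁.a₃ = 0 ∧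
      (∀ Q : E.geomPoints, π Q = 0 ↔ Q = 0 ∨ Q = toGeomPoints E (Affine.Point.some s y hP)) ∧
      (∀ T : E.geomPoints, T ≠ 0 → T + T = 0 → T ≠ toGeomPoints E (Affine.Point.some s y hP) →
        π T = toGeomPoints E₁ (Affine.Point.some s₁ y₁ hP₁)) ∧
      ((Rank1Residual.GoodOrd E 2 ∨ Rank1Residual.Mult E 2) → (Rank1Residual.GoodOrd E₁ 2 ∨ Rank1Residual.Mult E₁ 2) →
        (TwoTorsionRamifiedAtTwo s ↔ ¬ TwoTorsionRamifiedAtTwo s₁) ∧ (TwoTorsionOdd E s ↔ ¬ TwoTorsionOdd E₁ s₁)) := by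
  set C : VariableChange ℚ := ⟨1, s, -E.a₁ / 2, y⟩ with hC
  haveI hNF : (C • E).IsTwoTorsionNF :=
    isTwoTorsionNF_smul_of_two_nsmul_eq_zero two_ne_zero hP (by rw [Affine.negY]; linear_combination hy)
  obtain ⟨D, hD⟩ := hasGlobalMinimalModel_rat_holds (C • E).twoIsogenyCodomain
  set E₁ : WeierstrassCurve ℚ := D • (C • E).twoIsogenyCodomain with hE₁
  haveI : E₁.IsGloballyMinimal := hD
  have hlink : D⁻¹ • E₁ = (C • E).twoIsogenyCodomain := inv_smul_smul D _
  haveI : (D⁻¹ • E₁).IsTwoTorsionNF := by rw [hlink]; infer_instance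
  have hE₁eq : E₁.toAffine.Equation (D⁻¹).r (D⁻¹).t := equation_r_t_of_isTwoTorsionNF_smul E₁ D⁻¹
  have hP₁ : E₁.toAffine.Nonsingular (D⁻¹).r (D⁻¹).t := Affine.equation_iff_nonsingular.mp hE₁eq
  have hy₁ : 2 * (D⁻¹).t + E₁.a₁ * (D⁻¹).r + E₁.a₃ = 0 := two_mul_t_add_eq_zero_of_isTwoTorsionNF_smul E₁ D⁻¹
  let π : Isogeny E E₁ :=
    (VariableChange.toIsogeny (C • E).twoIsogenyCodomain D).comp
      ((C • E).twoIsogeny.comp (VariableChange.toIsogeny E C))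
  have hT : VariableChange.toIsogeny E C (toGeomPoints E (Affine.Point.some s y hP)) = (C • E).geomTwoTorsionPoint :=
    toIsogeny_toGeomPoints_eq_geomTwoTorsionPoint E hP hy
  refine ⟨E₁, inferInstance, hD, π, (D⁻¹).r, (D⁻¹).t, hP₁, hy₁, fun Q ↦ ?_, fun T hT0 hT2 hTS ↦ ?_, fun hE hE₁ ↦ ?_⟩
  · -- kernel
    show VariableChange.toIsogeny _ D ((C • E).twoIsogeny (VariableChange.toIsogeny E C Q)) = 0 ↔ _
    rw [← map_zero (VariableChange.toIsogeny (C • E).twoIsogenyCodomain D),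
      (VariableChange.toIsogeny_injective _ D).eq_iff, twoIsogeny_apply, ← AddMonoidHom.mem_ker,
      mem_ker_twoIsogenyGeomHom_iff, ← hT, ← map_zero (VariableChange.toIsogeny E C),
      (VariableChange.toIsogeny_injective E C).eq_iff, (VariableChange.toIsogeny_injective E C).eq_iff]
  · -- the dual point
    show VariableChange.toIsogeny _ D ((C • E).twoIsogeny (VariableChange.toIsogeny E C T)) = _
    have h0' : VariableChange.toIsogeny E C T ≠ 0 := fun h ↦
      hT0 (VariableChange.toIsogeny_injective E C (h.trans (map_zero _).symm))
    have h2' : VariableChange.toIsogeny E C T + VariableChange.toIsogeny E C T = 0 := by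
      rw [← map_add, hT2, map_zero]
    have hT' : VariableChange.toIsogeny E C T ≠ (C • E).geomTwoTorsionPoint := fun h ↦
      hTS (VariableChange.toIsogeny_injective E C (h.trans hT.symm))
    rw [twoIsogeny_eq_geomTwoTorsionPoint (C • E) h0' h2' hT']
    exact toIsogeny_geomTwoTorsionPoint _ D hP₁
  · -- edge laws
    exact ramified_odd_dual_of_twoIsogeny_of_goodOrd_or_mult E E₁ C D⁻¹ hE hE₁ hlink

end Step

end Summit.BirchSwinnertonDyer.BirchSwinnertonDyer.Theorems.DepletionAtTwo.Walk

end
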